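import Literature.Analysis.FluidPDE.HardSphereDynamics
import HarnessLib

/-!
# Hard-sphere dynamics: uniqueness of trajectories and label symmetry of the flow
(trunk: FluidKinetic / T-KINETIC, item K2; discharges `Kinetic.IsHardSphereTrajectory.unique`,
`Kinetic.HardSphereFlow.flow_eq_ae`)

Proofs of the elementary deterministic uniqueness facts about hard-sphere trajectories recorded
as named facts in `Literature.Analysis.FluidPDE.HardSphereDynamics` (companion to
`Literature.Analysis.FluidPDE.HardSphereDynamicsProofs`, which treats left limits and time
reversal; sources: Gallagher–Saint-Raymond–Texier 2013 §4.1, Prop. 4.1.1, and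
Cercignani–Illner–Pulvirenti 1994 §4.2, App. 4.A):

* `Kinetic.IsHardSphereTrajectory.unique_holds` — forward uniqueness of hard-sphere trajectories
  over a Hausdorff position space (the first time of disagreement is analysed: positions are
  continuous, hence agree there; either it is a collision time of both curves, and then the
  colliding pair, the pre-collisional left limits and so the post-collisional values agree, or it
  is not, and then both curves are the same free flight up to and slightly beyond it);
* `Kinetic.IsHardSphereTrajectory.comp_perm` — relabelling the particles of a trajectory gives a
  trajectory;
* `Kinetic.HardSphereFlow.flow_comp_perm_ae` — consequently a hard-sphere flow commutes with the
  relabelling of particles Liouville-almost everywhere (this is what makes the law at time `t` of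
  a symmetric initial law symmetric, GST 2013 §1.1 (1.1.3), §4.2);
* `Kinetic.HardSphereFlow.flow_eq_ae_holds` — two hard-sphere flows agree almost everywhere.

## References

* I. Gallagher, L. Saint-Raymond, B. Texier, *From Newton to Boltzmann: hard spheres and
  short-range potentials*, Zurich Lectures in Advanced Mathematics, EMS (2013), §1.1, §4.1
  (Prop. 4.1.1), §4.2.
* C. Cercignani, R. Illner, M. Pulvirenti, *The Mathematical Theory of Dilute Gases* (1994),
  §4.2, Appendix 4.A.
-/

open MeasureTheory Set Filter Topology
open scoped ENNReal

namespace Literature.Analysis.FluidPDE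

noncomputable section

section Kinetic

variable {d : Type*} [Fintype d] {X : Type*} {N : ℕ}

/-! ## Relabelling particles -/

section Perm

variable {G : Geometry d X} {ε : ℝ}

/-- The hard-sphere domain is invariant under relabelling of the particles (restated from
`BBGKYMarginals.comp_perm_mem_hardSphereDomain_iff` to keep this file's imports at K2). [folklore] -/
theorem perm_mem_hardSphereDomain_iff (σ : Equiv.Perm (Fin N)) (z : Config N d X) :
    (z ∘ σ : Config N d X) ∈ hardSphereDomain G N ε ↔ z ∈ hardSphereDomain G N ε := by
  simp only [mem_hardSphereDomain, Function.comp_apply]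
  refine ⟨fun h i j hij => ?_, fun h i j hij => h _ _ (σ.injective.ne hij)⟩
  simpa using h (σ.symm i) (σ.symm j) (σ.symm.injective.ne hij)

/-- Contact sets under relabelling: `z ∘ σ` has the pair `(i, j)` in contact iff `z` has the pair
`(σ i, σ j)` in contact. [folklore] -/
theorem perm_mem_contactSet_iff (σ : Equiv.Perm (Fin N)) (z : Config N d X) (i j : Fin N) :
    (z ∘ σ : Config N d X) ∈ contactSet G N ε i j ↔ z ∈ contactSet G N ε (σ i) (σ j) := by
  simp only [mem_contactSet, perm_mem_hardSphereDomain_iff, Function.comp_apply]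

/-- Relabelling does not change the set of collision times of a curve. [folklore] -/
theorem collisionTimes_comp_perm (σ : Equiv.Perm (Fin N)) (γ : ℝ → Config N d X) :
    collisionTimes G ε (fun t => (γ t ∘ σ : Config N d X)) = collisionTimes G ε γ := by
  ext t
  simp only [mem_collisionTimes, perm_mem_contactSet_iff]
  constructor
  · rintro ⟨i, j, hij, h⟩
    exact ⟨σ i, σ j, σ.injective.ne hij, h⟩
  · rintro ⟨i, j, hij, h⟩
    refine ⟨σ.symm i, σ.symm j, σ.symm.injective.ne hij, ?_⟩
    simpa using h

/-- Free flight commutes with relabelling. [folklore] -/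
theorem freeFlight_comp_perm (σ : Equiv.Perm (Fin N)) (t : ℝ) (z : Config N d X) :
    freeFlight G t (z ∘ σ) = (freeFlight G t z ∘ σ : Config N d X) := rfl

/-- Incoming pairs under relabelling. [folklore] -/
theorem isIncoming_comp_perm_iff (σ : Equiv.Perm (Fin N)) (z : Config N d X) (i j : Fin N) :
    IsIncoming G (z ∘ σ) i j ↔ IsIncoming G z (σ i) (σ j) := Iff.rfl

/-- The elastic collision of a pair commutes with relabelling: colliding `(i, j)` in `z ∘ σ` is
colliding `(σ i, σ j)` in `z` and relabelling (`i ≠ j`). [folklore] -/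
theorem collidePair_comp_perm {i j : Fin N} (hij : i ≠ j) (σ : Equiv.Perm (Fin N))
    (z : Config N d X) :
    collidePair G i j (z ∘ σ) = (collidePair G (σ i) (σ j) z ∘ σ : Config N d X) := by
  have hσ : σ i ≠ σ j := σ.injective.ne hij
  funext k
  simp only [Function.comp_apply]
  by_cases hkj : k = j
  · subst hkj
    rw [collidePair_apply_right, collidePair_apply_right]
    rfl
  by_cases hki : k = i
  · subst hki
    rw [collidePair_apply_left hkj, collidePair_apply_left hσ]
    rfl
  · rw [collidePair_apply_of_ne hki hkj,
      collidePair_apply_of_ne (σ.injective.ne hki) (σ.injective.ne hkj)]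
    rfl

variable [TopologicalSpace X]

/-- **Relabelled trajectories are trajectories**: if `γ` is a hard-sphere trajectory then so is
`t ↦ γ t ∘ σ` for every permutation `σ` of the particles (the dynamics of identical spheres is
label-blind; GST 2013 §1.1 (1.1.3) and §4.2, CIP 1994 §4.2). [folklore] -/
theorem IsHardSphereTrajectory.comp_perm {γ : ℝ → Config N d X}
    (h : IsHardSphereTrajectory G ε N γ) (σ : Equiv.Perm (Fin N)) :
    IsHardSphereTrajectory G ε N fun t => (γ t ∘ σ : Config N d X) where
  mem t := (perm_mem_hardSphereDomain_iff σ _).2 (h.mem t)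
  locFinite a b := by
    rw [collisionTimes_comp_perm]
    exact h.locFinite a b
  pos_continuous i := h.pos_continuous (σ i)
  free s t hst hfree := by
    rw [collisionTimes_comp_perm] at hfree
    change (γ t ∘ σ : Config N d X) = freeFlight G (t - s) (γ s ∘ σ)
    rw [h.free s t hst hfree]
    rfl
  binary t i j hij hct := by
    rw [perm_mem_contactSet_iff] at hct
    have hσ : σ i ≠ σ j := σ.injective.ne hij
    obtain ⟨huniq, zl, hzl, hin, hγ⟩ := h.binary t (σ i) (σ j) hσ hct
    refine ⟨fun i' j' hij' hct' => ?_, ⟨zl ∘ σ, ?_, hin, ?_⟩⟩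
    · rw [perm_mem_contactSet_iff] at hct'
      have key := congrArg (Finset.image σ.symm) (huniq (σ i') (σ j') (σ.injective.ne hij') hct')
      simpa [Finset.image_insert, Finset.image_singleton] using key
    · have hc : Continuous fun z : Config N d X => (z ∘ σ : Config N d X) :=
        continuous_pi fun i => continuous_apply (σ i)
      exact (hc.tendsto zl).comp hzl
    · change (γ t ∘ σ : Config N d X) = collidePair G i j (zl ∘ σ)
      rw [collidePair_comp_perm hij, hγ]

end Perm

/-! ## Forward uniqueness of hard-sphere trajectories -/

section Unique

variable [TopologicalSpace X] {G : Geometry d X} {ε : ℝ} {γ γ' : ℝ → Config N d X}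

omit [TopologicalSpace X] in
/-- Membership in a contact set only depends on the positions. [folklore] -/
theorem mem_contactSet_iff_of_pos_eq {i j : Fin N} {z w : Config N d X}
    (h : ∀ k, (z k).1 = (w k).1) : z ∈ contactSet G N ε i j ↔ w ∈ contactSet G N ε i j := by
  simp only [mem_contactSet, mem_hardSphereDomain, h]

omit [TopologicalSpace X] in
/-- Being a collision time only depends on the positions at that time. [folklore] -/
theorem mem_collisionTimes_iff_of_pos_eq {t : ℝ} (h : ∀ k, (γ t k).1 = (γ' t k).1) :
    t ∈ collisionTimes G ε γ ↔ t ∈ collisionTimes G ε γ' := by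
  simp only [mem_collisionTimes, mem_contactSet_iff_of_pos_eq h]

/-- Two hard-sphere trajectories which agree at time `s` and both have no collision in `(s, t]`
agree at time `t ≥ s` (both are the free flight of the common value). [folklore] -/
theorem IsHardSphereTrajectory.eq_of_free (h : IsHardSphereTrajectory G ε N γ)
    (h' : IsHardSphereTrajectory G ε N γ') {s t : ℝ} (hst : s ≤ t) (hs : γ s = γ' s)
    (hfree : ∀ u ∈ Ioc s t, u ∉ collisionTimes G ε γ ∧ u ∉ collisionTimes G ε γ') :
    γ t = γ' t := by
  rw [h.free s t hst fun u hu => (hfree u hu).1, h'.free s t hst fun u hu => (hfree u hu).2, hs]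

/-- **Forward uniqueness of hard-sphere trajectories** (GST 2013 §4.1; CIP 1994 App. 4.A):
discharge of the named fact `IsHardSphereTrajectory.unique`. Proof: if the two trajectories
disagreed somewhere after `t₀`, let `τ` be the infimum of the disagreement times. Positions are
continuous, so they agree at `τ`; if `τ` is a collision time (of one, hence of both curves: this
only depends on the positions) the colliding pair is in contact for both, the pre-collisional
left limits agree (Hausdorff), hence so do the post-collisional values; otherwise both curves are
the free flight of their common value at the last collision time before `τ`. In either case they
agree at `τ`, and then, collision times being locally finite, on a right neighbourhood of `τ` by
free flight — contradicting the choice of `τ`. [cite: GST2013, §4.1] -/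
theorem IsHardSphereTrajectory.unique_holds :
    IsHardSphereTrajectory.unique (G := G) (ε := ε) (γ := γ) (γ' := γ') := by
  intro _ h h' t₀ h0
  classical
  by_contra hne
  obtain ⟨t₁, ht₁, hne₁⟩ : ∃ t₁, t₀ ≤ t₁ ∧ γ t₁ ≠ γ' t₁ := by
    by_contra hall
    push Not at hall
    exact hne fun t ht => hall t ht
  set S : Set ℝ := {t | t₀ ≤ t ∧ γ t ≠ γ' t} with hS
  have hSne : S.Nonempty := ⟨t₁, ht₁, hne₁⟩
  have hSbdd : BddBelow S := ⟨t₀, fun t ht => ht.1⟩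
  set τ := sInf S with hτ
  have hτ₀ : t₀ ≤ τ := le_csInf hSne fun t ht => ht.1
  have hagree : ∀ t, t₀ ≤ t → t < τ → γ t = γ' t := fun t h1 h2 => by
    by_contra hne'
    exact (lt_irrefl t) (h2.trans_le (csInf_le hSbdd ⟨h1, hne'⟩))
  -- both families of collision times are locally finite: a common collision-free window
  have hwindow : ∀ a b : ℝ, ((collisionTimes G ε γ ∪ collisionTimes G ε γ') ∩ Icc a b).Finite :=
    fun a b => ((h.locFinite a b).union (h'.locFinite a b)).subset (by
      rintro u ⟨hu | hu, hI⟩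
      exacts [Or.inl ⟨hu, hI⟩, Or.inr ⟨hu, hI⟩])
  -- Step A: agreement at `τ`
  have hA : γ τ = γ' τ := by
    rcases hτ₀.eq_or_lt with heq | hlt
    · rw [← heq]; exact h0
    have hev : γ =ᶠ[𝓝[<] τ] γ' := by
      filter_upwards [Ioo_mem_nhdsLT hlt] with t ht
      exact hagree t ht.1.le ht.2
    -- positions agree at `τ`
    have hpos : ∀ k, (γ τ k).1 = (γ' τ k).1 := by
      intro k
      have hc : Tendsto (fun t => (γ t k).1) (𝓝[<] τ) (𝓝 (γ τ k).1) :=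
        ((h.pos_continuous k).tendsto τ).mono_left nhdsWithin_le_nhds
      have hc' : Tendsto (fun t => (γ' t k).1) (𝓝[<] τ) (𝓝 (γ' τ k).1) :=
        ((h'.pos_continuous k).tendsto τ).mono_left nhdsWithin_le_nhds
      have heq : (fun t => (γ t k).1) =ᶠ[𝓝[<] τ] fun t => (γ' t k).1 := by
        filter_upwards [hev] with t ht
        rw [ht]
      exact tendsto_nhds_unique (hc.congr' heq) hc'
    by_cases hcol : τ ∈ collisionTimes G ε γ
    · -- a collision of both curves at `τ`: same pair, same left limit, same outcome
      obtain ⟨i, j, hij, hct⟩ := hcol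
      have hct' : γ' τ ∈ contactSet G N ε i j := (mem_contactSet_iff_of_pos_eq hpos).1 hct
      obtain ⟨-, zl, hzl, -, hγ⟩ := h.binary τ i j hij hct
      obtain ⟨-, zl', hzl', -, hγ'⟩ := h'.binary τ i j hij hct'
      have hzz : zl = zl' := tendsto_nhds_unique (hzl.congr' hev) hzl'
      rw [hγ, hγ', hzz]
    · -- no collision at `τ`: free flight from the last collision time before `τ`
      have hcol' : τ ∉ collisionTimes G ε γ' := fun hc =>
        hcol ((mem_collisionTimes_iff_of_pos_eq hpos).2 hc)
      set C' : Finset ℝ := insert t₀ (hwindow t₀ τ).toFinset with hC'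
      have hC'ne : C'.Nonempty := ⟨t₀, Finset.mem_insert_self _ _⟩
      set s := C'.max' hC'ne with hsdef
      have hs₀ : t₀ ≤ s := C'.le_max' t₀ (Finset.mem_insert_self _ _)
      have hsτ : s < τ := by
        have hsmem : s ∈ C' := C'.max'_mem hC'ne
        rcases Finset.mem_insert.1 hsmem with hs | hs
        · rw [hs]; exact hlt
        · have hsC := (hwindow t₀ τ).mem_toFinset.1 hs
          rcases hsC.2.2.eq_or_lt with hs' | hs'
          · exfalso
            rcases hsC.1 with hc | hc
            · exact hcol (hs' ▸ hc)
            · exact hcol' (hs' ▸ hc)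
          · exact hs'
      have hfree : ∀ u ∈ Ioc s τ, u ∉ collisionTimes G ε γ ∧ u ∉ collisionTimes G ε γ' := by
        intro u hu
        have key : u ∉ collisionTimes G ε γ ∪ collisionTimes G ε γ' := by
          intro huc
          have huC : u ∈ (collisionTimes G ε γ ∪ collisionTimes G ε γ') ∩ Icc t₀ τ :=
            ⟨huc, hs₀.trans hu.1.le, hu.2⟩
          have : u ≤ s :=
            C'.le_max' u (Finset.mem_insert_of_mem ((hwindow t₀ τ).mem_toFinset.2 huC))
          exact (not_le.2 hu.1) this
        exact ⟨fun hu' => key (Or.inl hu'), fun hu' => key (Or.inr hu')⟩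
      exact h.eq_of_free h' hsτ.le (hagree s hs₀ hsτ) hfree
  -- Step B: agreement on a right neighbourhood of `τ`
  obtain ⟨η, hη, hB⟩ : ∃ η > 0, ∀ t, τ < t → t < τ + η → γ t = γ' t := by
    set C' : Finset ℝ := insert (τ + 1) (hwindow τ (τ + 1)).toFinset with hC'
    have hC'ne : C'.Nonempty := ⟨τ + 1, Finset.mem_insert_self _ _⟩
    -- the first collision time strictly after `τ` (or `τ + 1`)
    set C'' : Finset ℝ := C'.filter fun u => τ < u with hC''
    have hC''ne : C''.Nonempty :=
      ⟨τ + 1, Finset.mem_filter.2 ⟨Finset.mem_insert_self _ _, by linarith⟩⟩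
    set m := C''.min' hC''ne with hmdef
    have hmτ : τ < m := (Finset.mem_filter.1 (C''.min'_mem hC''ne)).2
    have hm1 : m ≤ τ + 1 :=
      C''.min'_le _ (Finset.mem_filter.2 ⟨Finset.mem_insert_self _ _, by linarith⟩)
    refine ⟨m - τ, sub_pos.2 hmτ, fun t h1 h2 => ?_⟩
    have h2' : t < m := by linarith
    have hfree : ∀ u ∈ Ioc τ t, u ∉ collisionTimes G ε γ ∧ u ∉ collisionTimes G ε γ' := by
      intro u hu
      have key : u ∉ collisionTimes G ε γ ∪ collisionTimes G ε γ' := by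
        intro huc
        have huC : u ∈ (collisionTimes G ε γ ∪ collisionTimes G ε γ') ∩ Icc τ (τ + 1) :=
          ⟨huc, hu.1.le, by linarith [hu.2]⟩
        have hu'' : u ∈ C'' := Finset.mem_filter.2
          ⟨Finset.mem_insert_of_mem ((hwindow τ (τ + 1)).mem_toFinset.2 huC), hu.1⟩
        have : m ≤ u := C''.min'_le u hu''
        linarith [hu.2]
      exact ⟨fun hu' => key (Or.inl hu'), fun hu' => key (Or.inr hu')⟩
    exact h.eq_of_free h' h1.le hA hfree
  -- Step C: `τ + η` is a lower bound of the disagreement set, contradiction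
  have hle : τ + η ≤ τ := by
    refine le_csInf hSne fun t ht => ?_
    by_contra hlt
    push Not at hlt
    have hτt : τ ≤ t := csInf_le hSbdd ht
    rcases hτt.eq_or_lt with heq | hlt'
    · exact ht.2 (heq ▸ hA)
    · exact ht.2 (hB t hlt' hlt)
  linarith

end Unique

/-! ## Consequences for hard-sphere flows -/

section Flow

variable [MeasureSpace X] [TopologicalSpace X] {G : Geometry d X} {ε : ℝ}

namespace HardSphereFlow

/-- On good points whose relabelling is good, the flow commutes with relabelling at all forward
times (both `t ↦ Φ_t (z ∘ σ)` and `t ↦ (Φ_t z) ∘ σ` are hard-sphere trajectories issued from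
`z ∘ σ`; forward uniqueness). [folklore] -/
theorem flow_comp_perm_of_nonneg [T2Space X] (Φ : HardSphereFlow G ε N) (σ : Equiv.Perm (Fin N))
    {z : Config N d X} (hz : z ∈ Φ.good) (hzσ : (z ∘ σ : Config N d X) ∈ Φ.good) {t : ℝ}
    (ht : 0 ≤ t) : Φ.flow t (z ∘ σ) = (Φ.flow t z ∘ σ : Config N d X) := by
  have h1 : IsHardSphereTrajectory G ε N fun s => Φ.flow s (z ∘ σ) := Φ.isTrajectory _ hzσ
  have h2 : IsHardSphereTrajectory G ε N fun s => (Φ.flow s z ∘ σ : Config N d X) :=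
    (Φ.isTrajectory z hz).comp_perm σ
  have h0 : Φ.flow 0 (z ∘ σ) = (Φ.flow 0 z ∘ σ : Config N d X) := by
    rw [Φ.flow_zero _ hzσ, Φ.flow_zero _ hz]
  exact IsHardSphereTrajectory.unique_holds h1 h2 h0 (Set.mem_Ici.2 ht)

/-- The same at backward times, for good `z` such that `(Φ_t z) ∘ σ` is good (group property). [folklore] -/
theorem flow_comp_perm_of_neg [T2Space X] (Φ : HardSphereFlow G ε N) (σ : Equiv.Perm (Fin N))
    {z : Config N d X} (hz : z ∈ Φ.good) {t : ℝ} (ht : t < 0)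
    (hw : (Φ.flow t z ∘ σ : Config N d X) ∈ Φ.good) :
    Φ.flow t (z ∘ σ) = (Φ.flow t z ∘ σ : Config N d X) := by
  have hwg : Φ.flow t z ∈ Φ.good := Φ.mapsTo_good t hz
  have hneg : Φ.flow (-t) (Φ.flow t z ∘ σ) = (z ∘ σ : Config N d X) := by
    rw [flow_comp_perm_of_nonneg Φ σ hwg hw (by linarith), Φ.flow_neg_flow t hz]
  calc Φ.flow t (z ∘ σ) = Φ.flow t (Φ.flow (-t) (Φ.flow t z ∘ σ)) := by rw [hneg]
    _ = Φ.flow (t + -t) (Φ.flow t z ∘ σ) := (Φ.flow_add t (-t) _ hw).symm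
    _ = (Φ.flow t z ∘ σ : Config N d X) := by rw [add_neg_cancel, Φ.flow_zero _ hw]

variable [SigmaFinite (volume : Measure X)]

omit [TopologicalSpace X] in
/-- Relabelling of the particles preserves the Liouville measure (it preserves the product
Lebesgue measure and the hard-sphere domain). [folklore] -/
theorem measurePreserving_comp_perm_liouville (σ : Equiv.Perm (Fin N)) :
    MeasurePreserving (fun z : Config N d X => (z ∘ σ : Config N d X))
      (liouville G N ε) (liouville G N ε) := by
  set e := MeasurableEquiv.piCongrLeft (fun _ : Fin N => X × EuclideanSpace ℝ d) σ.symm with hedef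
  have he : (e : Config N d X → Config N d X) = fun z => (z ∘ σ : Config N d X) := by
    funext z i
    simp [hedef, MeasurableEquiv.coe_piCongrLeft, Equiv.piCongrLeft_apply_eq_cast]
  have hvol : MeasurePreserving e volume volume :=
    volume_measurePreserving_piCongrLeft (fun _ : Fin N => X × EuclideanSpace ℝ d) σ.symm
  have hpre : e ⁻¹' hardSphereDomain G N ε = hardSphereDomain G N ε := by
    ext z
    rw [Set.mem_preimage, he]
    exact perm_mem_hardSphereDomain_iff σ z
  have key := hvol.restrict_preimage_emb e.measurableEmbedding (hardSphereDomain G N ε)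
  rw [hpre] at key
  rw [liouville_eq, ← he]
  exact key

/-- Liouville-almost every configuration has a good relabelling. [folklore] -/
theorem ae_comp_perm_mem_good (Φ : HardSphereFlow G ε N) (σ : Equiv.Perm (Fin N)) :
    ∀ᵐ z ∂liouville G N ε, (z ∘ σ : Config N d X) ∈ Φ.good := by
  have hP := measurePreserving_comp_perm_liouville (G := G) (ε := ε) (d := d) (N := N) σ
  have h0 : liouville G N ε ((fun z : Config N d X => (z ∘ σ : Config N d X)) ⁻¹' Φ.goodᶜ) = 0 := by
    rw [hP.measure_preimage Φ.measurableSet_good.compl.nullMeasurableSet, Φ.measure_compl_good]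
  rw [ae_iff]
  exact h0

/-- **Hard-sphere flows commute with relabelling, almost everywhere** (the dynamics of identical
particles is label-blind, which is why the `N`-particle distribution stays invariant under
permutations, GST 2013 §1.1 (1.1.3) and §4.2; here derived from forward uniqueness of
trajectories, the group property and the invariance of the Liouville measure under the flow and
under relabelling): for every permutation `σ` and time `t`,
`Φ_t (z ∘ σ) = (Φ_t z) ∘ σ` for Liouville-a.e. `z`. [folklore] -/
theorem flow_comp_perm_ae [T2Space X] (Φ : HardSphereFlow G ε N) (σ : Equiv.Perm (Fin N))
    (t : ℝ) : ∀ᵐ z ∂liouville G N ε, Φ.flow t (z ∘ σ) = (Φ.flow t z ∘ σ : Config N d X) := by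
  have hP := measurePreserving_comp_perm_liouville (G := G) (ε := ε) (d := d) (N := N) σ
  have hmeas : MeasurableSet ((fun z : Config N d X => (z ∘ σ : Config N d X)) ⁻¹' Φ.goodᶜ) :=
    hP.measurable Φ.measurableSet_good.compl
  have h0 : liouville G N ε ((fun z : Config N d X => (z ∘ σ : Config N d X)) ⁻¹' Φ.goodᶜ) = 0 := by
    rw [hP.measure_preimage Φ.measurableSet_good.compl.nullMeasurableSet, Φ.measure_compl_good]
  have h2 : ∀ᵐ z ∂liouville G N ε, (Φ.flow t z ∘ σ : Config N d X) ∈ Φ.good := by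
    have : liouville G N ε (Φ.flow t ⁻¹'
        ((fun z : Config N d X => (z ∘ σ : Config N d X)) ⁻¹' Φ.goodᶜ)) = 0 := by
      rw [(Φ.measurePreserving t).measure_preimage hmeas.nullMeasurableSet, h0]
    rw [ae_iff]
    exact this
  filter_upwards [Φ.ae_mem_good, Φ.ae_comp_perm_mem_good σ, h2] with z hz hzσ hw
  rcases le_or_gt 0 t with ht | ht
  · exact flow_comp_perm_of_nonneg Φ σ hz hzσ ht
  · exact flow_comp_perm_of_neg Φ σ hz ht hw

omit [SigmaFinite (volume : Measure X)] in
/-- **Uniqueness of the hard-sphere flow** (GST 2013 Prop. 4.1.1): discharge of the named fact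
`HardSphereFlow.flow_eq_ae` — two hard-sphere flows agree Liouville-a.e. at every time (forward
uniqueness of trajectories on the common good set for `t ≥ 0`; for `t < 0` the group property
reduces to the forward statement at the point `Φ_t z`, which is good for both flows for a.e. `z`
by invariance of the Liouville measure). [cite: GST2013, Prop. 4.1.1] -/
theorem flow_eq_ae_holds : HardSphereFlow.flow_eq_ae (G := G) (ε := ε) (N := N) := by
  intro _ Φ Ψ t
  -- forward agreement on the common good set
  have hfwd : ∀ z, z ∈ Φ.good → z ∈ Ψ.good → ∀ s, 0 ≤ s → Φ.flow s z = Ψ.flow s z := by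
    intro z hzΦ hzΨ s hs
    have h0 : Φ.flow 0 z = Ψ.flow 0 z := by rw [Φ.flow_zero z hzΦ, Ψ.flow_zero z hzΨ]
    exact IsHardSphereTrajectory.unique_holds (Φ.isTrajectory z hzΦ) (Ψ.isTrajectory z hzΨ) h0
      (Set.mem_Ici.2 hs)
  have h2 : ∀ᵐ z ∂liouville G N ε, Φ.flow t z ∈ Ψ.good := by
    have : liouville G N ε (Φ.flow t ⁻¹' Ψ.goodᶜ) = 0 := by
      rw [(Φ.measurePreserving t).measure_preimage Ψ.measurableSet_good.compl.nullMeasurableSet,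
        Ψ.measure_compl_good]
    rw [ae_iff]
    exact this
  filter_upwards [Φ.ae_mem_good, Ψ.ae_mem_good, h2] with z hzΦ hzΨ hw
  rcases le_or_gt 0 t with ht | ht
  · exact hfwd z hzΦ hzΨ t ht
  · have hwΦ : Φ.flow t z ∈ Φ.good := Φ.mapsTo_good t hzΦ
    have hneg : Ψ.flow (-t) (Φ.flow t z) = z := by
      rw [← hfwd _ hwΦ hw (-t) (by linarith), Φ.flow_neg_flow t hzΦ]
    calc Φ.flow t z = Ψ.flow (t + -t) (Φ.flow t z) := by rw [add_neg_cancel, Ψ.flow_zero _ hw]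
      _ = Ψ.flow t (Ψ.flow (-t) (Φ.flow t z)) := Ψ.flow_add t (-t) _ hw
      _ = Ψ.flow t z := by rw [hneg]

end HardSphereFlow

end Flow

end Kinetic

end

end Literature.Analysis.FluidPDE
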